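import Summits.QuantumFields.YangMills.Theorems.BalabanUVNodesN08LargeFieldRowAE
import Summits.QuantumFields.YangMills.Theorems.BalabanUVNodesN08AlphaEq324RowAC

/-!
# Route «BalabanUVNodes», Track-A DAG node N08 = [Balaban1985UV3] Thm 1 p. 257 ∕ Thm 2 p. 272 — ROW B25 `dU_k`-ALMOST EVERYWHERE AT THE LANE'S AC TOWER FROM THE
# EDITED (α)-AC CLAUSE (the (3.24) row in print's output-sandwich currency at ANY cumulant letter, range-honest bundle) AND THE a.e. MASS BOUND — the a.e. twin of
# gen 3's junction `…RowACMassBound` (p609560), i.e. dag-n08-w1 g4's file 20 `…N08LargeFieldRowAE` (p612673) re-entered one (α)-currency lower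

Cell `pub-ymgap`, seat `pub-ymgap-dag-n08-w4` gen 4 (INTENT-2; sequel of p607065 and of dag-n08-w1's p612673).  `bears_on: R4∕N08`; `--supports stmt-QuantumFields-20542`
(K1⁷, helper).  THEOREMS ONLY (def-free), sorry-free, standard axioms; dag-n08-w1's generic §1 `lf_towerAC3_ae_of_massBound_ae` and the lane's `Balaban3D/Proofs/*AC` modules
consumed BY NAME, untouched.

THE POINT (located, count-neutral).  dag-n08-w1's files 16∕17∕19 deliver the mass bound of the AC road only `dU_k`-ALMOST EVERYWHERE (`m_k ≤ e^{c_k}` a.e. from a weakly closed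
family), and file 20 records what that buys from the (α)-AC clause AS LANDED (`AlphaAC.RunAlphaAC`, tilted (3.24) pair, all-steps bundle): B25 `dU_k`-a.e. at `towerOfAC`.  On
the road of record the (3.24) row may be read in print's sandwich currency at any letter over the range-honest bundle (gen 3, (R-AC-324)); file 20's lane theorem reads ONLY
the rows (67) ∘ large field and (68) of its antecedent, which the edition `…RowAC.RunAlphaEq324CoreLTAtAC 𝔊 𝔠 X 𝔖 𝔄 c` carries VERBATIM — so the a.e. row holds from the
edition too, and file 20's §2 is recovered as the χ-letter instance (`coreLTAtAC_cum_of_runAlphaAC`).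
* §1 ★★ `lf_towerOfAC_ae_of_coreLTAtAC_of_massBound_ae` — B25 `dU_k`-a.e. at `towerOfAC 𝔠.lane X 𝔖`, exponent `(d + c_m)|T₁^{(k)}|`, from the edition at ANY letter `c` over
  `𝔄 : AlphaDataLTAC` + «`m_k(h,·) ≤ e^{c_m|T₁^{(k)}|}` `dU_k`-a.e., `1 ≤ k ≤ K`», on the `≤`-family; `…_of_alphaAC_…_via_eq324` (file 20 §2 as the χ-letter instance).
* §2 ★★ `lf_towerOfAC_ae_at_print_of_coreLTAtAC_of_massBound_ae` — A6 ∃X form at PRINT'S OWN averaging pinned to the record (file 9 §2's inhabitant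
  `exists_externalInputsAC_ofPrint`), the a.e. bound stated X-free on print's iterated Radon–Nikodym masses `MassesAC.massRecAC … (avOfPrint N S)` (the output currency of
  files 16∕17∕19), the (α)-AC antecedent in print's (3.24) currency at the supplier's letter.
HONEST FRAMING: count-neutral helper; B25 a.e. ONLY, under HYPOTHESES (the edited (α)-AC rows + an a.e. mass bound = N08's object gap in AC currency); the POINTWISE row,
`PrintedUV3V`, Thm 1–2 at the record are NOT proved; N08 NOT discharged; one finite 𝕋⁴ programme at fixed ε, Bałaban AS PRINTED — R4 closes the conditional finite-𝕋⁴ rung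
`BalabanLadder.UV` only; the Yang–Mills mass gap (Clay) is NOT proved by any of this; nothing continuum ∕ ℝ⁴ ∕ OS.

References: [Balaban1985UV3] T. Bałaban, Commun. Math. Phys. 102 (1985) 255–275 — (41) p. 266, (67)–(68) p. 273, pp. 273–274; [Balaban1985Averaging] (15) p. 19;
[Balaban1982Higgs1] (3.24) p. 616.
-/

noncomputable section

open MeasureTheory

namespace Summit.QuantumFields.YangMills.Theorems.BalabanUVNodesN08AlphaEq324RowACLargeFieldAE

open scoped Matrix.Norms.L2Operator
open Literature.MathematicalPhysics.QuantumFieldTheory.Balaban1983to89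
open Literature.MathematicalPhysics.QuantumFieldTheory.Balaban1983to89.B10 (TowerRun pFun)
open Literature.MathematicalPhysics.QuantumFieldTheory.Balaban1983to89.Node00 (SU)
open Literature.MathematicalPhysics.QuantumFieldTheory.Balaban1983to89.B10RunsOfRecord
open Literature.MathematicalPhysics.QuantumFieldTheory.Balaban1985CMP102
open Literature.MathematicalPhysics.QuantumFieldTheory.Balaban1985CMP102.Setting
open Literature.MathematicalPhysics.QuantumFieldTheory.Balaban1985CMP102.Theorems (Family)
open Summit.QuantumFields.Balaban3D
open Summit.QuantumFields.Balaban3D.Carriers (nblkOf StepSeries Hist rcolOf eps1Of epsSOf)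
open Summit.QuantumFields.Balaban3D.Proofs
open Summit.QuantumFields.Balaban3D.Proofs.ScalesArithmetic
open Summit.QuantumFields.Balaban3D.Proofs.Constants (eps0Of consts3_d_eq_log)
open Summit.QuantumFields.Balaban3D.Proofs.FamilyLE (le_of_eps0Of thresholds_of_le)
open Summit.QuantumFields.Balaban3D.Proofs.Family (prov_hb₁ prov_hb₂)
open Summit.QuantumFields.Balaban3D.Proofs.GroupModelLieC (lieC)
open Summit.QuantumFields.Balaban3D.Proofs.StandardAC (ExternalInputsAC)
open Summit.QuantumFields.Balaban3D.Proofs.InputsAC (inputOfAC towerOfAC)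
open Summit.QuantumFields.Balaban3D.Proofs.AlphaAC (AlphaDataAC RunAlphaAC)
open Summit.QuantumFields.YangMills.BalabanUVNodes.N08Thm2AsPrintedAtSlotOfRecordAC (exists_externalInputsAC_ofPrint)
open Summit.QuantumFields.YangMills.BalabanUVNodes.N08LargeFieldRowAE (lf_towerAC3_ae_of_massBound_ae lf_towerOfAC_ae_of_alphaAC_of_massBound_ae)
open Summit.QuantumFields.YangMills.Theorems.BalabanUVNodesN08AlphaEq324RowAC

/-! ## §1 Row B25 almost everywhere at the lane's AC tower from the EDITED (α)-AC clause and the a.e. mass bound -/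
section Lane

variable {L : ℕ} {S : Scales L} {G : Type} [GaugeGroup G] [MeasurableSpace G] [HaarData G] {𝔊 : GroupModel G} {𝔠 : Primitives.AlphaConsts L 𝔊.N}
  {X : ExternalInputsAC S G} {𝔖 : ∀ k, StepSeries S G ↥(lieC 𝔊) (nblkOf S 𝔠.lane.carrier k) k} {𝔄 : AlphaDataLTAC 𝔊 𝔠 X 𝔖}
  {c : ∀ k, Hist S.P (k + 1) → GaugeField S.P (k + 1) G → ℕ → ℝ}
  (hle : S.g ^ 2 * S.ε₀ ≤ (min 𝔠.gamma0 1) ^ 2)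
include hle

/-- ★★ **ROW B25, `dU_k`-a.e., AT THE LANE'S AC TOWER `towerOfAC 𝔠.lane X 𝔖` FROM THE EDITED (α)-AC CLAUSE AT AN ARBITRARY CUMULANT LETTER AND THE a.e. MASS BOUND** on
the `≤`-family — dag-n08-w1's `lf_towerOfAC_ae_of_alphaAC_of_massBound_ae` with `RunAlphaAC ↦ RunAlphaEq324CoreLTAtAC … c` (range-honest bundle, (3.24) row as the printed
sandwich `Eq324` at `c`): the lane theorem reads only the rows (67) ∘ large field (`hLF67`) and (68) (`h68`), carried verbatim by the edition; every lane-side hypothesis of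
the generic `lf_towerAC3_ae_of_massBound_ae` discharged identically. [cite: Balaban1985UV3, pp.273–274 + (67)–(68) p.273 + (39)–(41) p.266 + (7) p.257; Balaban1982Higgs1, (3.24) p.616] -/
theorem lf_towerOfAC_ae_of_coreLTAtAC_of_massBound_ae (R : RunAlphaEq324CoreLTAtAC 𝔊 𝔠 X 𝔖 𝔄 c) {cm : ℝ} (hcm : 0 ≤ cm)
    (hmass : ∀ k, 1 ≤ k → k ≤ S.K → ∀ h : Hist S.P k, ∀ᵐ U ∂(fieldMeasure S.P k G),
      (inputOfAC 𝔠.lane X 𝔖).W.mass k h U ≤ Real.exp (cm * S.sites k)) :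
    ∀ k, k ≤ (towerOfAC 𝔠.lane X 𝔖).K → ∀ᵐ U ∂(fieldMeasure S.P k G),
      (towerOfAC 𝔠.lane X 𝔖).LF k U (fun h => -((towerOfAC 𝔠.lane X 𝔖).mainT k h U) + (towerOfAC 𝔠.lane X 𝔖).Zterm k h)
        ≤ Real.exp ((𝔠.lane.consts.d + cm) * (towerOfAC 𝔠.lane X 𝔖).sites k) := by
  have hr₀ : 0 ≤ 𝔠.lane.carrier.r₀ := le_trans zero_le_one 𝔠.one_le_r₀
  have hCz : 0 ≤ 𝔠.lane.carrier.Cz + 𝔠.lane.carrier.Cv := add_nonneg 𝔠.Cz_nonneg 𝔠.Cv_nonneg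
  have hc₁ : 0 ≤ 𝔠.lane.carrier.c₁ := by show (0 : ℝ) ≤ 3; norm_num
  have hA : 0 ≤ (𝔠.lane.carrier.Cz + 𝔠.lane.carrier.Cv) + 𝔠.lane.carrier.C₅ + 𝔠.lane.carrier.C₆ +
      (|𝔠.lane.carrier.logσ₀| + 𝔠.lane.carrier.dg) * 𝔠.lane.carrier.c₁ := by
    have := 𝔠.lane.carrier.dg_nonneg
    have := abs_nonneg 𝔠.lane.carrier.logσ₀
    have h5 : 0 ≤ 𝔠.lane.carrier.C₅ := 𝔠.C₅_nonneg
    have h6 : 0 ≤ 𝔠.lane.carrier.C₆ := 𝔠.C₆_nonneg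
    positivity
  have hρ : (0 : ℝ) ≤ (𝔠.lane.carrier.R₁ + 1) * 𝔠.lane.carrier.M₁ := by
    have : 0 ≤ 𝔠.lane.carrier.R₁ := 𝔠.R₁_nonneg
    positivity
  exact lf_towerAC3_ae_of_massBound_ae 𝔊 𝔠.lane.consts (consts3_d_eq_log 𝔠.lane.F 𝔠.lane.sc) rfl S.hL.2 (inputOfAC 𝔠.lane X 𝔖) (gs := 1) (ε := S.g0sq)
    (fun k hk => by exact_mod_cast sites_eq_card S k (by omega))
    (fun k h U hh => StandardAC.stdTowerInputAC_mass_eq_zero_of_not_admissible X 𝔠.lane.carrier 𝔖 k h U hh)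
    hcm hmass (g0sq_pos S) 𝔠.C68_pos 𝔠.lane.F.b₀_pos 𝔠.lane.F.p₀_pos
    (fun j => by rw [show 𝔠.lane.consts.g = 1 from rfl, show 𝔠.lane.consts.L = (L : ℝ) from rfl]; exact gk_eq_gRun_norm S j)
    (fun j hj => (thresholds_of_le hle j hj.le).2.2.2.1) R.hLF67 R.h68 𝔠.lane.F.M₁_pos
    (LargeFieldStd.rcolOf_antitone 𝔠.lane.carrier 𝔠.R₁_nonneg hr₀) hρ hr₀ (LargeFieldStd.rcolOf_le 𝔠.lane.carrier 𝔠.R₁_nonneg hr₀)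
    (LargeFieldStd.zcoefOf_nonneg 𝔠.lane.carrier hCz 𝔠.C₅_nonneg 𝔠.C₆_nonneg hc₁)
    (LargeFieldStd.zcoefOf_le 𝔠.lane.carrier hCz 𝔠.C₅_nonneg 𝔠.C₆_nonneg hc₁) hA
    (fun j hj => ⟨gk_pos S j, gk_le_one S S.gK_le_one j hj⟩) le_rfl 𝔠.prov_r₀p₀ (prov_hb₁ 𝔠 𝔊.N_pos) (prov_hb₂ 𝔠 𝔊.N_pos)

omit hle in
/-- **… and dag-n08-w1's file 20 §2 IS THE χ-LETTER INSTANCE**: from `RunAlphaAC 𝔊 𝔠 X 𝔖 𝔄′` (the (α)-AC clause AS LANDED) the a.e. row is recovered through p607065's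
`coreLTAtAC_cum_of_runAlphaAC` (edition at the lane's letter `(𝔖 ·).cum` over `restrictLTAC 𝔄′`) — the edition loses nothing along file 20.
[cite: Balaban1985UV3, pp.273–274 + (67)–(68) p.273 (bookkeeping)] -/
theorem lf_towerOfAC_ae_of_alphaAC_of_massBound_ae_via_eq324 (hle : S.g ^ 2 * S.ε₀ ≤ (min 𝔠.gamma0 1) ^ 2) {𝔄' : AlphaDataAC 𝔊 𝔠 X 𝔖}
    (R : RunAlphaAC 𝔊 𝔠 X 𝔖 𝔄') {cm : ℝ} (hcm : 0 ≤ cm)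
    (hmass : ∀ k, 1 ≤ k → k ≤ S.K → ∀ h : Hist S.P k, ∀ᵐ U ∂(fieldMeasure S.P k G),
      (inputOfAC 𝔠.lane X 𝔖).W.mass k h U ≤ Real.exp (cm * S.sites k)) :
    ∀ k, k ≤ (towerOfAC 𝔠.lane X 𝔖).K → ∀ᵐ U ∂(fieldMeasure S.P k G),
      (towerOfAC 𝔠.lane X 𝔖).LF k U (fun h => -((towerOfAC 𝔠.lane X 𝔖).mainT k h U) + (towerOfAC 𝔠.lane X 𝔖).Zterm k h)
        ≤ Real.exp ((𝔠.lane.consts.d + cm) * (towerOfAC 𝔠.lane X 𝔖).sites k) :=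
  lf_towerOfAC_ae_of_coreLTAtAC_of_massBound_ae (𝔄 := restrictLTAC 𝔄') (c := fun k => (𝔖 k).cum) hle (coreLTAtAC_cum_of_runAlphaAC R) hcm hmass

end Lane

/-! ## §2 At print's own averaging pinned to the record (A6 form): the a.e. bound stated on print's iterated Radon–Nikodym masses -/
section Print

variable {N : ℕ} [NeZero N] {L : ℕ}

variable (N L) in
/-- ★★ **ROW B25, `dU_k`-a.e., AT THE AC TOWERS OVER PRINT'S OWN AVERAGING PINNED TO THE RECORD, FROM THE EDITED (α)-AC ROWS — A6 ∃X FORM** (file 9 §2's inhabitant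
`exists_externalInputsAC_ofPrint`: such inputs EXIST; their masses ARE `MassesAC.massRecAC M₁ Rcol ε_L ε_S (avOfPrint N S)` by `rfl`): for every `SU(N)`, `𝔠`, `εbg`, `c_m ≥ 0`
THERE ARE AC external inputs `X` at print's averaging with the record's minimisers such that, for every expansion data `𝔖`, RANGE-HONEST (α)-AC data `𝔄` and cumulant letter
`c` (e.g. the free Gaussian moment-cumulants a [BenfattoEtAl1978]∕class sandwich supplier speaks), **the edited (α)-AC rows on a member `S` of the family ∧
«`massRecAC … (avOfPrint N S) k h ≤ exp(c_m|T₁^{(k)}|)` `dU_k`-a.e., `1 ≤ k ≤ K`» ⇒ B25 holds `dU_k`-a.e. at `towerOfAC 𝔠.lane (X S) (𝔖 S)` with `d + c_m`** (dag-n08-w1's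
`lf_towerOfAC_ae_at_print_of_alphaAC_of_massBound_ae`, one (α)-currency lower). [cite: Balaban1985UV3, pp.273–274 + (41) p.266; Balaban1985Averaging, (15) p.19; Balaban1982Higgs1, (3.24) p.616] -/
theorem lf_towerOfAC_ae_at_print_of_coreLTAtAC_of_massBound_ae (𝔊 : GroupModel (SU N)) (𝔠 : Primitives.AlphaConsts L 𝔊.N) (εbg cm : ℝ) (hcm : 0 ≤ cm) :
    ∃ X : ∀ S : Scales L, ExternalInputsAC S (SU N), (∀ S, (X S).av = avOfPrint N S) ∧
      (∀ (S : Scales L) k (V : GaugeField S.P (k + 1) (SU N)), (X S).Uk k V = UkA N (fun S => (X S).av) S (k + 1) εbg V) ∧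
      ∀ (𝔖 : ∀ (S : Scales L) (k : ℕ), StepSeries S (SU N) ↥(lieC 𝔊) (nblkOf S 𝔠.lane.carrier k) k)
        (𝔄 : ∀ S : Scales L, AlphaDataLTAC 𝔊 𝔠 (X S) (𝔖 S))
        (c : ∀ (S : Scales L) (k : ℕ), Hist S.P (k + 1) → GaugeField S.P (k + 1) (SU N) → ℕ → ℝ) (S : Family L (eps0Of 𝔠.gamma0)),
        RunAlphaEq324CoreLTAtAC 𝔊 𝔠 (X S.1) (𝔖 S.1) (𝔄 S.1) (c S.1) →
        (∀ k, 1 ≤ k → k ≤ S.1.K → ∀ h : Hist S.1.P k, ∀ᵐ U ∂(fieldMeasure S.1.P k (SU N)),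
          MassesAC.massRecAC 𝔠.lane.carrier.M₁ (rcolOf S.1 𝔠.lane.carrier) (eps1Of S.1 𝔠.lane.carrier) (epsSOf S.1 𝔠.lane.carrier) (avOfPrint N S.1) k h U ≤
            Real.exp (cm * S.1.sites k)) →
        ∀ k, k ≤ (towerOfAC 𝔠.lane (X S.1) (𝔖 S.1)).K → ∀ᵐ U ∂(fieldMeasure S.1.P k (SU N)),
          (towerOfAC 𝔠.lane (X S.1) (𝔖 S.1)).LF k U
              (fun h => -((towerOfAC 𝔠.lane (X S.1) (𝔖 S.1)).mainT k h U) + (towerOfAC 𝔠.lane (X S.1) (𝔖 S.1)).Zterm k h)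
            ≤ Real.exp ((𝔠.lane.consts.d + cm) * (towerOfAC 𝔠.lane (X S.1) (𝔖 S.1)).sites k) := by
  obtain ⟨X, hav, -, hUk⟩ := exists_externalInputsAC_ofPrint N L εbg
  refine ⟨X, hav, hUk, fun 𝔖 𝔄 c S R hmass => lf_towerOfAC_ae_of_coreLTAtAC_of_massBound_ae (le_of_eps0Of S.1 S.2) R hcm fun k hk1 hkK h => ?_⟩
  have hX : (X S.1).av = avOfPrint N S.1 := hav S.1
  have hm : ∀ U, (inputOfAC 𝔠.lane (X S.1) (𝔖 S.1)).W.mass k h U =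
      MassesAC.massRecAC 𝔠.lane.carrier.M₁ (rcolOf S.1 𝔠.lane.carrier) (eps1Of S.1 𝔠.lane.carrier) (epsSOf S.1 𝔠.lane.carrier) (avOfPrint N S.1) k h U := by
    intro U
    rw [show (inputOfAC 𝔠.lane (X S.1) (𝔖 S.1)).W.mass k h U = _ from StandardAC.stdTowerInputAC_mass (X S.1) 𝔠.lane.carrier (𝔖 S.1) k h U, hX]
  filter_upwards [hmass k hk1 hkK h] with U hU
  rw [hm U]
  exact hU

end Print

end Summit.QuantumFields.YangMills.Theorems.BalabanUVNodesN08AlphaEq324RowACLargeFieldAE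

end
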